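import Summits.CriticalPhenomena.PercolationContinuityZ3.Theorems.PercNearOneGluingNoHeavyLowerTailKnQuestion8CoefficientwiseTwoSourceDomination
import Summits.CriticalPhenomena.PercolationContinuityZ3.Theorems.PercNearOneGluingNoHeavyLowerTailKnQuestion8CoefficientwiseNoCoreAdjPoint
import Summits.CriticalPhenomena.PercolationContinuityZ3.Theorems.PercNearOneGluingNoHeavyLowerTailKnQuestion8CoefficientwiseNoCoreNbhd
import Summits.CriticalPhenomena.PercolationContinuityZ3.Theorems.PercNearOneGluingNoHeavyLowerTailKnQuestion8CoefficientwiseRootSectorTwo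
import Summits.CriticalPhenomena.PercolationContinuityZ3.Theorems.PercNearOneGluingNoHeavyLowerTailKnQuestion8CoefficientwiseTwoSource
import HarnessLib

/-!
# The SERIES POINT at the root: `NO-CORE(y)[1_u,g] = NO-CORE^{G−u}(y)[1_p,g] + 2·A^{G−u}(p,y)[g]` for `N(u) = {x,p}` — prim-lf-2 gen 53 (part 2 of 2)

Support file (`--supports stmt-CriticalPhenomena-4575`, closed), prover `prim-lf-2` (gen 53).  No definitions, no named facts, no sorries; standard axioms.
Memo `prim-lf-2/CW-SERIES-gen53.md` §1–§2; part 1 is `…CoefficientwiseTwoSourceDomination.lean` (THEOREM A, `twoSource_noCore_domination`).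

Setting.  Finite multigraph `ends : ι → Sym2 V`, root `x`, `K(s) = openCluster (ends '' s) x`; CONJECTURE NO-CORE (prim-lf-2 gen 46) for the point function `1_u` reads
`NO-CORE(y)[1_u,g] := Σ_{s : ¬(y ∈ K s ∧ y ∈ K sᶜ)} ([u ∈ K s] − [u ∈ K sᶜ])·(g(K s) − g(K sᶜ)) ≥ 0`.  Let the point `u ∉ {x,y,p}` have exactly two edges, `i₁ = ux` (to the ROOT)
and `i₂ = up`, and let `g` ignore `u` (a 'series point at the root': `u` subdivides a root edge `xp`).  Resolving the colours of `i₁, i₂` (sub-multigraph `G − u` = edge type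
`{j // j ∉ {i₁,i₂}}`, clusters `K″`, `P″ = C_p`):  both red — `K = {u} ∪ K″ ∪ P″`, `K̄ = K̄″`; `i₁` red, `i₂` blue — `K = {u} ∪ K″`, `[u ∈ K̄] = [p ∈ K̄″]`; the two other classes are
the swap images.  Hence
* `noCore_seriesPoint_eq` — `NO-CORE(y)[1_u,g] = NO-CORE^{G−u}(y)[1_p,g] + 2·A^{G−u}(p,y)[g]`,  `A(p,y)[g] = Σ_{t : ¬(y ∈ K″t ∪ P″t ∧ y ∈ K″tᶜ)} (g(K″t ∪ P″t) − g(K″tᶜ))`;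
* `noCore_seriesPoint_ge` — by THEOREM A (`A ≥ 0`):  `NO-CORE(y)[1_u,g] ≥ NO-CORE^{G−u}(y)[1_p,g]`  (subdividing a root edge by a point can only help);
* `noCore_seriesPoint_adj_nonneg` — if moreover `p ∼ y` then `NO-CORE(y)[1_u,g] ≥ 0` (gen 48's `noCore_adj_point_nonneg` on `G − u`).
This settles the 'series point' residue of prim-lf-2 gen 51 (CW-ROOTEDGE-gen51 §3): together with gens 46–51, CONJECTURE NO-CORE for the point functions `(1_u, 1_w)` holds on
EVERY graph with at most six vertices (prim-lf-2 code/gen53/c/nccov53.c: 80 112 instances `(G,y)`, 0 uncovered; n = 7, m ≤ 9: 336 of 1 999 128 left).  Also: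
* `mem_openCluster_union_seriesPair_iff` — the cluster lemma `C_x(T ∪ {ux, up}) = {u} ∪ C_x(T) ∪ C_p(T)` for `T` avoiding `u`.
[cite: KozmaNitzan2024, Questions 8–9 (§5.5 p. 36) (context: the Question-8 pocket covariance programme)]
-/

namespace Summit.CriticalPhenomena.PercolationContinuityZ3.Theorems

open Finset Literature.Probability.Percolation

namespace Coefficientwise

variable {ι V : Type*} [Fintype ι] [DecidableEq ι] (ends : ι → Sym2 V) (x : V)

omit [Fintype ι] in
/-- **A point between the root and `p`.**  If `i₁ = ux`, `i₂ = up` and no edge of `T` contains `u`, then `v ∈ C_x(T ∪ {i₁,i₂}) ↔ v = u ∨ v ∈ C_x(T) ∨ v ∈ C_p(T)`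
(two root edges at `u` — gen 37's `mem_openCluster_insert_two_rootEdges_iff` — read from the root `x`, which lies in the same cluster).
[cite: KozmaNitzan2024, §5.5 (context only; folklore)] -/
theorem mem_openCluster_union_seriesPair_iff (T : Finset ι) {u p : V} {i₁ i₂ : ι} (hi₁ : ends i₁ = s(u, x)) (hi₂ : ends i₂ = s(u, p))
    (hT : ∀ i ∈ T, u ∉ ends i) (v : V) :
    v ∈ openCluster (ends '' (↑(insert i₁ (insert i₂ T)) : Set ι)) x ↔
      (v = u ∨ v ∈ openCluster (ends '' (↑T : Set ι)) x ∨ v ∈ openCluster (ends '' (↑T : Set ι)) p) := by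
  have hx : x ∈ openCluster (ends '' (↑(insert i₁ (insert i₂ T)) : Set ι)) u :=
    (mem_openCluster_insert_two_rootEdges_iff ends hi₁ hi₂ hT).mpr (Or.inr (Or.inl (mem_openCluster_self _ x)))
  rw [← openCluster_eq_of_mem _ hx]
  exact mem_openCluster_insert_two_rootEdges_iff ends hi₁ hi₂ hT

omit [Fintype ι] in
/-- The power set of a singleton (local copy of gen 50's `powerset_singleton_eq`, kept private to spare an import). [cite: KozmaNitzan2024, §5.5 (context only; bookkeeping)] -/
private theorem powerset_singleton_eq_pair (e : ι) : ({e} : Finset ι).powerset = {∅, {e}} := by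
  ext s
  rw [Finset.mem_powerset, Finset.subset_singleton_iff, Finset.mem_insert, Finset.mem_singleton]

section seriesPoint

variable {u p y : V} {i₁ i₂ : ι} (g : Set V → ℝ)

open Classical in
/-- **The series-point identity.**  Let `u ∉ {x, y, p}` have exactly the two edges `i₁ = ux`, `i₂ = up` (`i₁ ≠ i₂`), and let `g` ignore `u`.  Then
`NO-CORE(y)[1_u,g] = NO-CORE^{G−u}(y)[1_p,g] + 2·A^{G−u}(p,y)[g]`, the right side over the cube of the multigraph with edge type `{j // j ∉ {i₁,i₂}}`, where
`A(p,y)[g] = Σ_{t : ¬(y ∈ K″t ∪ P″t ∧ y ∈ K″tᶜ)} (g(K″t ∪ P″t) − g(K″tᶜ))` is the two-source exclusion of part 1.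
[cite: KozmaNitzan2024, Questions 8–9 (§5.5 p. 36) (context)] -/
theorem noCore_seriesPoint_eq (hi₁ : ends i₁ = s(u, x)) (hi₂ : ends i₂ = s(u, p)) (hne : i₁ ≠ i₂)
    (hdeg : ∀ i, u ∈ ends i → i = i₁ ∨ i = i₂) (hxu : x ≠ u) (hpu : p ≠ u) (hyu : y ≠ u)
    (hgu : ∀ C : Set V, g (insert u C) = g C) :
    ∑ s ∈ univ.filter (fun s : Finset ι => ¬ (y ∈ openCluster (ends '' (↑s : Set ι)) x ∧ y ∈ openCluster (ends '' (↑(sᶜ) : Set ι)) x)),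
      ((if u ∈ openCluster (ends '' (↑s : Set ι)) x then (1 : ℝ) else 0) - (if u ∈ openCluster (ends '' (↑(sᶜ) : Set ι)) x then (1 : ℝ) else 0)) *
        (g (openCluster (ends '' (↑s : Set ι)) x) - g (openCluster (ends '' (↑(sᶜ) : Set ι)) x)) =
    ∑ t ∈ univ.filter (fun t : Finset {j : ι // j ∉ ({i₁, i₂} : Finset ι)} =>
        ¬ (y ∈ openCluster ((fun j : {j : ι // j ∉ ({i₁, i₂} : Finset ι)} => ends j.1) '' (↑t : Set {j : ι // j ∉ ({i₁, i₂} : Finset ι)})) x ∧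
           y ∈ openCluster ((fun j : {j : ι // j ∉ ({i₁, i₂} : Finset ι)} => ends j.1) '' (↑(tᶜ) : Set {j : ι // j ∉ ({i₁, i₂} : Finset ι)})) x)),
      ((if p ∈ openCluster ((fun j : {j : ι // j ∉ ({i₁, i₂} : Finset ι)} => ends j.1) '' (↑t : Set {j : ι // j ∉ ({i₁, i₂} : Finset ι)})) x then (1 : ℝ) else 0) -
          (if p ∈ openCluster ((fun j : {j : ι // j ∉ ({i₁, i₂} : Finset ι)} => ends j.1) '' (↑(tᶜ) : Set {j : ι // j ∉ ({i₁, i₂} : Finset ι)})) x then (1 : ℝ) else 0)) *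
        (g (openCluster ((fun j : {j : ι // j ∉ ({i₁, i₂} : Finset ι)} => ends j.1) '' (↑t : Set {j : ι // j ∉ ({i₁, i₂} : Finset ι)})) x) -
          g (openCluster ((fun j : {j : ι // j ∉ ({i₁, i₂} : Finset ι)} => ends j.1) '' (↑(tᶜ) : Set {j : ι // j ∉ ({i₁, i₂} : Finset ι)})) x))
    + 2 * ∑ t ∈ univ.filter (fun t : Finset {j : ι // j ∉ ({i₁, i₂} : Finset ι)} =>
        ¬ (y ∈ openCluster ((fun j : {j : ι // j ∉ ({i₁, i₂} : Finset ι)} => ends j.1) '' (↑t : Set {j : ι // j ∉ ({i₁, i₂} : Finset ι)})) x ∪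
               openCluster ((fun j : {j : ι // j ∉ ({i₁, i₂} : Finset ι)} => ends j.1) '' (↑t : Set {j : ι // j ∉ ({i₁, i₂} : Finset ι)})) p ∧
           y ∈ openCluster ((fun j : {j : ι // j ∉ ({i₁, i₂} : Finset ι)} => ends j.1) '' (↑(tᶜ) : Set {j : ι // j ∉ ({i₁, i₂} : Finset ι)})) x)),
      (g (openCluster ((fun j : {j : ι // j ∉ ({i₁, i₂} : Finset ι)} => ends j.1) '' (↑t : Set {j : ι // j ∉ ({i₁, i₂} : Finset ι)})) x ∪
           openCluster ((fun j : {j : ι // j ∉ ({i₁, i₂} : Finset ι)} => ends j.1) '' (↑t : Set {j : ι // j ∉ ({i₁, i₂} : Finset ι)})) p) -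
        g (openCluster ((fun j : {j : ι // j ∉ ({i₁, i₂} : Finset ι)} => ends j.1) '' (↑(tᶜ) : Set {j : ι // j ∉ ({i₁, i₂} : Finset ι)})) x)) := by
  classical
  set D : Finset ι := {i₁, i₂} with hD
  set Pr : ι → Prop := fun j => j ∉ D with hPr
  set emb := Function.Embedding.subtype Pr with hemb
  set KK : Finset ι → Set V := fun s => openCluster (ends '' (↑s : Set ι)) x with hKK
  set K' : Finset {j : ι // Pr j} → Set V := fun t => openCluster ((fun j : {j : ι // Pr j} => ends j.1) '' (↑t : Set {j : ι // Pr j})) x with hK'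
  set P' : Finset {j : ι // Pr j} → Set V := fun t => openCluster ((fun j : {j : ι // Pr j} => ends j.1) '' (↑t : Set {j : ι // Pr j})) p with hP'
  -- the three target summands
  set NC : Finset {j : ι // Pr j} → ℝ := fun t => if ¬ (y ∈ K' t ∧ y ∈ K' tᶜ) then
      ((if p ∈ K' t then (1 : ℝ) else 0) - (if p ∈ K' tᶜ then (1 : ℝ) else 0)) * (g (K' t) - g (K' tᶜ)) else 0 with hNC
  set AA : Finset {j : ι // Pr j} → ℝ := fun t => if ¬ (y ∈ K' t ∪ P' t ∧ y ∈ K' tᶜ) then (g (K' t ∪ P' t) - g (K' tᶜ)) else 0 with hAA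
  set F : Finset ι → Finset ι → ℝ := fun s s' => if ¬ (y ∈ KK s ∧ y ∈ KK s') then
      ((if u ∈ KK s then (1 : ℝ) else 0) - (if u ∈ KK s' then (1 : ℝ) else 0)) * (g (KK s) - g (KK s')) else 0 with hF
  rw [Finset.sum_filter, Finset.sum_filter, Finset.sum_filter]
  change ∑ s : Finset ι, F s sᶜ = ∑ t : Finset {j : ι // Pr j}, NC t + 2 * ∑ t : Finset {j : ι // Pr j}, AA t
  -- sub-cube bookkeeping
  have hKT : ∀ t : Finset {j : ι // Pr j}, K' t = KK (t.map emb) := by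
    intro t; simp only [hK', hKK, Finset.coe_map, Set.image_image]; rfl
  have hPT : ∀ t : Finset {j : ι // Pr j}, P' t = openCluster (ends '' (↑(t.map emb) : Set ι)) p := by
    intro t; simp only [hP', Finset.coe_map, Set.image_image]; rfl
  have hnoT : ∀ t : Finset {j : ι // Pr j}, ∀ i ∈ t.map emb, u ∉ ends i := by
    intro t i hi hui
    obtain ⟨hP, _⟩ := (mem_map_subtype_iff Pr t i).mp hi
    apply hP
    rcases hdeg i hui with rfl | rfl
    · simp [hD]
    · simp [hD]
  have huK' : ∀ t : Finset {j : ι // Pr j}, u ∉ K' t := fun t => by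
    rw [hKT t]; exact not_mem_openCluster_of_no_edge ends x (t.map emb) hxu (hnoT t)
  have huP' : ∀ t : Finset {j : ι // Pr j}, u ∉ P' t := fun t => by
    rw [hPT t]; exact not_mem_openCluster_of_no_edge ends p (t.map emb) hpu (hnoT t)
  -- the four traces on `D`
  have hDD : ∀ T : Finset ι, T ∪ D = insert i₁ (insert i₂ T) := by
    intro T; ext a; simp only [hD, Finset.mem_union, Finset.mem_insert, Finset.mem_singleton]; tauto
  have hD1 : D \ {i₁} = {i₂} := by
    ext a; simp only [hD, Finset.mem_sdiff, Finset.mem_insert, Finset.mem_singleton]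
    constructor
    · rintro ⟨h | h, h'⟩; exact absurd h h'; exact h
    · intro h; subst h; exact ⟨Or.inr rfl, fun h => hne h.symm⟩
  have hD2 : D \ {i₂} = {i₁} := by
    ext a; simp only [hD, Finset.mem_sdiff, Finset.mem_insert, Finset.mem_singleton]
    constructor
    · rintro ⟨h | h, h'⟩; exact h; exact absurd h h'
    · intro h; subst h; exact ⟨Or.inl rfl, hne⟩
  have hins : ∀ (T : Finset ι) (i : ι), T ∪ {i} = insert i T := by
    intro T i; rw [Finset.union_comm, ← Finset.insert_eq]
  -- CLASS `D` red (both edges of `u` red): `K = {u} ∪ K″ ∪ P″`, `K̄ = K̄″`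
  have hRR : ∀ r : Finset {j : ι // Pr j}, F (r.map emb ∪ D) (rᶜ.map emb ∪ (D \ D)) = AA r := by
    intro r
    have hmem : ∀ v, v ∈ KK (r.map emb ∪ D) ↔ (v = u ∨ v ∈ K' r ∨ v ∈ P' r) := by
      intro v; rw [hKT r, hPT r]; change v ∈ openCluster (ends '' (↑(r.map emb ∪ D) : Set ι)) x ↔ _
      rw [hDD]; exact mem_openCluster_union_seriesPair_iff ends x (r.map emb) hi₁ hi₂ (hnoT r) v
    have hu1 : u ∈ KK (r.map emb ∪ D) := (hmem u).mpr (Or.inl rfl)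
    have hy1 : y ∈ KK (r.map emb ∪ D) ↔ y ∈ K' r ∪ P' r := by
      rw [hmem y, Set.mem_union]; exact ⟨fun h => h.resolve_left hyu, fun h => Or.inr h⟩
    have hg1 : g (KK (r.map emb ∪ D)) = g (K' r ∪ P' r) := by
      refine apply_eq_of_agree_off g hgu (fun v hv => ?_) ?_
      · rw [hmem v, Set.mem_union]; exact ⟨fun h => h.resolve_left hv, fun h => Or.inr h⟩
      · intro h; rcases h with h | h; exact huK' r h; exact huP' r h
    have h2 : KK (rᶜ.map emb ∪ (D \ D)) = K' rᶜ := by rw [Finset.sdiff_self, Finset.union_empty, hKT rᶜ]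
    simp only [hF, hAA, h2, hy1, hg1, hu1, huK' rᶜ, if_true, if_false]
    by_cases hc : ¬ (y ∈ K' r ∪ P' r ∧ y ∈ K' rᶜ)
    · rw [if_pos hc, if_pos hc]; ring
    · rw [if_neg hc, if_neg hc]
  -- CLASS `∅` red (both edges of `u` blue): the swap image, `= AA rᶜ`
  have hcc : ∀ r : Finset {j : ι // Pr j}, rᶜᶜ = r := fun r => compl_compl r
  have hBB : ∀ r : Finset {j : ι // Pr j}, F (r.map emb ∪ ∅) (rᶜ.map emb ∪ (D \ ∅)) =
      (if ¬ (y ∈ K' rᶜ ∪ P' rᶜ ∧ y ∈ K' r) then (g (K' rᶜ ∪ P' rᶜ) - g (K' r)) else 0) := by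
    intro r
    have hmem : ∀ v, v ∈ KK (rᶜ.map emb ∪ D) ↔ (v = u ∨ v ∈ K' rᶜ ∨ v ∈ P' rᶜ) := by
      intro v; rw [hKT rᶜ, hPT rᶜ]; change v ∈ openCluster (ends '' (↑(rᶜ.map emb ∪ D) : Set ι)) x ↔ _
      rw [hDD]; exact mem_openCluster_union_seriesPair_iff ends x (rᶜ.map emb) hi₁ hi₂ (hnoT rᶜ) v
    have hu1 : u ∈ KK (rᶜ.map emb ∪ D) := (hmem u).mpr (Or.inl rfl)
    have hy1 : y ∈ KK (rᶜ.map emb ∪ D) ↔ y ∈ K' rᶜ ∪ P' rᶜ := by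
      rw [hmem y, Set.mem_union]; exact ⟨fun h => h.resolve_left hyu, fun h => Or.inr h⟩
    have hg1 : g (KK (rᶜ.map emb ∪ D)) = g (K' rᶜ ∪ P' rᶜ) := by
      refine apply_eq_of_agree_off g hgu (fun v hv => ?_) ?_
      · rw [hmem v, Set.mem_union]; exact ⟨fun h => h.resolve_left hv, fun h => Or.inr h⟩
      · intro h; rcases h with h | h; exact huK' rᶜ h; exact huP' rᶜ h
    have h2 : KK (r.map emb ∪ ∅) = K' r := by rw [Finset.union_empty, hKT r]
    rw [Finset.sdiff_empty]
    simp only [hF, h2, hy1, hg1, hu1, huK' r, if_true, if_false]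
    by_cases hc : ¬ (y ∈ K' r ∧ y ∈ K' rᶜ ∪ P' rᶜ)
    · have hc' : ¬ (y ∈ K' rᶜ ∪ P' rᶜ ∧ y ∈ K' r) := fun h => hc ⟨h.2, h.1⟩
      rw [if_pos hc, if_pos hc']; ring
    · have hc' : ¬ ¬ (y ∈ K' rᶜ ∪ P' rᶜ ∧ y ∈ K' r) := fun h => hc (fun h' => h ⟨h'.2, h'.1⟩)
      rw [if_neg hc, if_neg hc']
  -- CLASS `{i₁}` red (`ux` red, `up` blue): `K = {u} ∪ K″`, `[u ∈ K̄] = [p ∈ K̄″]`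
  have hRB : ∀ r : Finset {j : ι // Pr j}, F (r.map emb ∪ {i₁}) (rᶜ.map emb ∪ (D \ {i₁})) =
      (if ¬ (y ∈ K' r ∧ y ∈ K' rᶜ) then ((1 : ℝ) - (if p ∈ K' rᶜ then (1 : ℝ) else 0)) * (g (K' r) - g (K' rᶜ)) else 0) := by
    intro r
    rw [hD1, hins, hins]
    obtain ⟨a1, b1, -⟩ := openCluster_insert_leafEdge ends x (r.map emb) hi₁ hxu hxu (hnoT r)
    obtain ⟨a2, b2, -⟩ := openCluster_insert_leafEdge ends x (rᶜ.map emb) hi₂ hpu hxu (hnoT rᶜ)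
    have a1' : ∀ v, v ≠ u → (v ∈ KK (insert i₁ (r.map emb)) ↔ v ∈ K' r) := fun v hv => by rw [hKT r]; exact a1 v hv
    have a2' : ∀ v, v ≠ u → (v ∈ KK (insert i₂ (rᶜ.map emb)) ↔ v ∈ K' rᶜ) := fun v hv => by rw [hKT rᶜ]; exact a2 v hv
    have hu1 : u ∈ KK (insert i₁ (r.map emb)) := b1.mpr (mem_openCluster_self _ x)
    have hu2 : (u ∈ KK (insert i₂ (rᶜ.map emb)) ↔ p ∈ K' rᶜ) := by rw [hKT rᶜ]; exact b2
    have hy1 := a1' y hyu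
    have hy2 := a2' y hyu
    have hg1 : g (KK (insert i₁ (r.map emb))) = g (K' r) := apply_eq_of_agree_off g hgu a1' (huK' r)
    have hg2 : g (KK (insert i₂ (rᶜ.map emb))) = g (K' rᶜ) := apply_eq_of_agree_off g hgu a2' (huK' rᶜ)
    simp only [hF, hy1, hy2, hg1, hg2, hu1, hu2, if_true]
  -- CLASS `{i₂}` red (`ux` blue, `up` red): `[u ∈ K] = [p ∈ K″]`, `K̄ = {u} ∪ K̄″`
  have hBR : ∀ r : Finset {j : ι // Pr j}, F (r.map emb ∪ {i₂}) (rᶜ.map emb ∪ (D \ {i₂})) =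
      (if ¬ (y ∈ K' r ∧ y ∈ K' rᶜ) then ((if p ∈ K' r then (1 : ℝ) else 0) - (1 : ℝ)) * (g (K' r) - g (K' rᶜ)) else 0) := by
    intro r
    rw [hD2, hins, hins]
    obtain ⟨a1, b1, -⟩ := openCluster_insert_leafEdge ends x (r.map emb) hi₂ hpu hxu (hnoT r)
    obtain ⟨a2, b2, -⟩ := openCluster_insert_leafEdge ends x (rᶜ.map emb) hi₁ hxu hxu (hnoT rᶜ)
    have a1' : ∀ v, v ≠ u → (v ∈ KK (insert i₂ (r.map emb)) ↔ v ∈ K' r) := fun v hv => by rw [hKT r]; exact a1 v hv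
    have a2' : ∀ v, v ≠ u → (v ∈ KK (insert i₁ (rᶜ.map emb)) ↔ v ∈ K' rᶜ) := fun v hv => by rw [hKT rᶜ]; exact a2 v hv
    have hu1 : (u ∈ KK (insert i₂ (r.map emb)) ↔ p ∈ K' r) := by rw [hKT r]; exact b1
    have hu2 : u ∈ KK (insert i₁ (rᶜ.map emb)) := b2.mpr (mem_openCluster_self _ x)
    have hy1 := a1' y hyu
    have hy2 := a2' y hyu
    have hg1 : g (KK (insert i₂ (r.map emb))) = g (K' r) := apply_eq_of_agree_off g hgu a1' (huK' r)
    have hg2 : g (KK (insert i₁ (rᶜ.map emb))) = g (K' rᶜ) := apply_eq_of_agree_off g hgu a2' (huK' rᶜ)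
    simp only [hF, hy1, hy2, hg1, hg2, hu1, hu2, if_true]
  -- the two mixed classes add up to NO-CORE″
  have hmix : ∀ r : Finset {j : ι // Pr j},
      F (r.map emb ∪ {i₁}) (rᶜ.map emb ∪ (D \ {i₁})) + F (r.map emb ∪ {i₂}) (rᶜ.map emb ∪ (D \ {i₂})) = NC r := by
    intro r
    rw [hRB r, hBR r]
    simp only [hNC]
    by_cases hc : ¬ (y ∈ K' r ∧ y ∈ K' rᶜ)
    · rw [if_pos hc, if_pos hc, if_pos hc]; ring
    · rw [if_neg hc, if_neg hc, if_neg hc]; ring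
  -- split the cube along `D` and evaluate the four classes
  rw [sum_cube_eq_sum_powerset_subcube D F]
  have hi₁₂ : i₁ ∉ ({i₂} : Finset ι) := fun h => hne (Finset.mem_singleton.mp h)
  rw [show D.powerset = (insert i₁ ({i₂} : Finset ι)).powerset from rfl, Finset.sum_powerset_insert hi₁₂, powerset_singleton_eq_pair i₂,
    Finset.sum_pair (Finset.singleton_ne_empty i₂).symm, Finset.sum_pair (Finset.singleton_ne_empty i₂).symm]
  have hpair : insert i₁ ({i₂} : Finset ι) = D := rfl
  have hsing : insert i₁ (∅ : Finset ι) = {i₁} := by simp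
  rw [hpair, hsing]
  have eRR : ∑ r : Finset {j : ι // Pr j}, F (r.map emb ∪ D) (rᶜ.map emb ∪ (D \ D)) = ∑ r : Finset {j : ι // Pr j}, AA r :=
    Finset.sum_congr rfl fun r _ => hRR r
  have eBB : ∑ r : Finset {j : ι // Pr j}, F (r.map emb ∪ ∅) (rᶜ.map emb ∪ (D \ ∅)) = ∑ r : Finset {j : ι // Pr j}, AA r := by
    rw [Finset.sum_congr rfl (fun r _ => hBB r), ← sum_compl_eq AA]
    refine Finset.sum_congr rfl fun r _ => ?_
    simp only [hAA, hcc]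
  have eMix : ∑ r : Finset {j : ι // Pr j}, F (r.map emb ∪ {i₂}) (rᶜ.map emb ∪ (D \ {i₂})) +
      ∑ r : Finset {j : ι // Pr j}, F (r.map emb ∪ {i₁}) (rᶜ.map emb ∪ (D \ {i₁})) = ∑ r : Finset {j : ι // Pr j}, NC r := by
    rw [← Finset.sum_add_distrib]
    exact Finset.sum_congr rfl fun r _ => by rw [add_comm]; exact hmix r
  rw [eRR, eBB]
  linarith [eMix]

open Classical in
/-- **A series point at the root can be removed: `NO-CORE(y)[1_u,g] ≥ NO-CORE^{G−u}(y)[1_p,g]`** (for `N(u) = {x,p}`, `g` monotone ignoring `u`) — the identity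
`noCore_seriesPoint_eq` and THEOREM A (`twoSource_noCore_domination` on `G − u`).  [cite: KozmaNitzan2024, Questions 8–9 (§5.5 p. 36) (context)] -/
theorem noCore_seriesPoint_ge (hi₁ : ends i₁ = s(u, x)) (hi₂ : ends i₂ = s(u, p)) (hne : i₁ ≠ i₂)
    (hdeg : ∀ i, u ∈ ends i → i = i₁ ∨ i = i₂) (hxu : x ≠ u) (hpu : p ≠ u) (hyu : y ≠ u)
    (hg : Monotone g) (hgu : ∀ C : Set V, g (insert u C) = g C) :
    ∑ t ∈ univ.filter (fun t : Finset {j : ι // j ∉ ({i₁, i₂} : Finset ι)} =>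
        ¬ (y ∈ openCluster ((fun j : {j : ι // j ∉ ({i₁, i₂} : Finset ι)} => ends j.1) '' (↑t : Set {j : ι // j ∉ ({i₁, i₂} : Finset ι)})) x ∧
           y ∈ openCluster ((fun j : {j : ι // j ∉ ({i₁, i₂} : Finset ι)} => ends j.1) '' (↑(tᶜ) : Set {j : ι // j ∉ ({i₁, i₂} : Finset ι)})) x)),
      ((if p ∈ openCluster ((fun j : {j : ι // j ∉ ({i₁, i₂} : Finset ι)} => ends j.1) '' (↑t : Set {j : ι // j ∉ ({i₁, i₂} : Finset ι)})) x then (1 : ℝ) else 0) -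
          (if p ∈ openCluster ((fun j : {j : ι // j ∉ ({i₁, i₂} : Finset ι)} => ends j.1) '' (↑(tᶜ) : Set {j : ι // j ∉ ({i₁, i₂} : Finset ι)})) x then (1 : ℝ) else 0)) *
        (g (openCluster ((fun j : {j : ι // j ∉ ({i₁, i₂} : Finset ι)} => ends j.1) '' (↑t : Set {j : ι // j ∉ ({i₁, i₂} : Finset ι)})) x) -
          g (openCluster ((fun j : {j : ι // j ∉ ({i₁, i₂} : Finset ι)} => ends j.1) '' (↑(tᶜ) : Set {j : ι // j ∉ ({i₁, i₂} : Finset ι)})) x)) ≤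
    ∑ s ∈ univ.filter (fun s : Finset ι => ¬ (y ∈ openCluster (ends '' (↑s : Set ι)) x ∧ y ∈ openCluster (ends '' (↑(sᶜ) : Set ι)) x)),
      ((if u ∈ openCluster (ends '' (↑s : Set ι)) x then (1 : ℝ) else 0) - (if u ∈ openCluster (ends '' (↑(sᶜ) : Set ι)) x then (1 : ℝ) else 0)) *
        (g (openCluster (ends '' (↑s : Set ι)) x) - g (openCluster (ends '' (↑(sᶜ) : Set ι)) x)) := by
  rw [noCore_seriesPoint_eq ends x g hi₁ hi₂ hne hdeg hxu hpu hyu hgu]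
  have hA := twoSource_noCore_domination (fun j : {j : ι // j ∉ ({i₁, i₂} : Finset ι)} => ends j.1) x p y g hg
  linarith

open Classical in
/-- **THEOREM: NO-CORE at a series point adjacent to the root.**  Let the point `u ∉ {x,y,p}` have exactly the two edges `i₁ = ux`, `i₂ = up` (`i₁ ≠ i₂`), let `p` be adjacent to
`y` through an edge `e₁` (`p ≠ y`), and let the monotone `g` ignore `u`.  Then
`0 ≤ NO-CORE(y)[1_u,g] = Σ_{s : ¬(y ∈ K s ∧ y ∈ K sᶜ)} ([u ∈ K s] − [u ∈ K sᶜ])·(g(K s) − g(K sᶜ))`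
(`noCore_seriesPoint_ge` + gen 48's `noCore_adj_point_nonneg` on `G − u`, where `e₁ ∉ {i₁,i₂}` survives).  This is the 'series point' shape of prim-lf-2 gen 51: with it CONJECTURE
NO-CORE for the point functions holds on every graph with at most six vertices.  [cite: KozmaNitzan2024, Questions 8–9 (§5.5 p. 36) (context)] -/
theorem noCore_seriesPoint_adj_nonneg {e₁ : ι} (hi₁ : ends i₁ = s(u, x)) (hi₂ : ends i₂ = s(u, p)) (hne : i₁ ≠ i₂)
    (hdeg : ∀ i, u ∈ ends i → i = i₁ ∨ i = i₂) (hxu : x ≠ u) (hpu : p ≠ u) (hyu : y ≠ u)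
    (he₁ : ends e₁ = s(y, p)) (hpy : p ≠ y)
    (hg : Monotone g) (hgu : ∀ C : Set V, g (insert u C) = g C) :
    0 ≤ ∑ s ∈ univ.filter (fun s : Finset ι => ¬ (y ∈ openCluster (ends '' (↑s : Set ι)) x ∧ y ∈ openCluster (ends '' (↑(sᶜ) : Set ι)) x)),
      ((if u ∈ openCluster (ends '' (↑s : Set ι)) x then (1 : ℝ) else 0) - (if u ∈ openCluster (ends '' (↑(sᶜ) : Set ι)) x then (1 : ℝ) else 0)) *
        (g (openCluster (ends '' (↑s : Set ι)) x) - g (openCluster (ends '' (↑(sᶜ) : Set ι)) x)) := by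
  refine le_trans ?_ (noCore_seriesPoint_ge ends x g hi₁ hi₂ hne hdeg hxu hpu hyu hg hgu)
  -- the edge `e₁ = yp` is not an edge at `u`
  have hne₁ : e₁ ∉ ({i₁, i₂} : Finset ι) := by
    intro h
    have hu : u ∉ ends e₁ := by
      rw [he₁, Sym2.mem_iff]; rintro (h' | h'); exact hyu h'.symm; exact hpu h'.symm
    rcases Finset.mem_insert.mp h with rfl | h2
    · exact hu (by rw [hi₁]; exact Sym2.mem_mk_left _ _)
    · rw [Finset.mem_singleton] at h2; subst h2
      exact hu (by rw [hi₂]; exact Sym2.mem_mk_left _ _)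
  have he₁' : (fun j : {j : ι // j ∉ ({i₁, i₂} : Finset ι)} => ends j.1) ⟨e₁, hne₁⟩ = s(y, p) := he₁
  exact noCore_adj_point_nonneg (fun j : {j : ι // j ∉ ({i₁, i₂} : Finset ι)} => ends j.1) x y p he₁' hpy g hg

end seriesPoint

end Coefficientwise

end Summit.CriticalPhenomena.PercolationContinuityZ3.Theorems
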